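import Literature.MathematicalPhysics.QuantumFieldTheory.BalabanRegulatorChart

/-!
# `stub_parabolicBlock` of line `perfect-action-regulator-chart` (crux `BalabanStepParabolic`) — candidate proof

Refuter drefute certificate (refuter-drefute-stmt-QuantumFields-9684-0): the registered stub statement
`ParabolicBlockOfSmooth` (skeleton v3, stated in full) is TRUE as typed. Witness: the odd/even extension
`φ' g y = if 0 ≤ g then φ g y else -φ (-g) y`, `Ψ' g y = Ψ |g| y`, constant `C' = 2C + 1`; every clause is a
one-variable mean value inequality (`norm_image_sub_le_of_norm_deriv_le_segment'` on sub-intervals of `[0, δ]`,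
`Convex.norm_image_sub_le_of_norm_hasFDerivWithin_le` on closed balls).
-/

open Metric Set

noncomputable section

namespace Summit.QuantumFields.YangMills.Theorems.BalabanStepParabolic

namespace SmoothBridge

open Literature.MathematicalPhysics.QuantumFieldTheory

variable {E : Type} [NormedAddCommGroup E] [NormedSpace ℝ E]
  {φ : ℝ → E → ℝ} {Ψ : ℝ → E → E} {A : E →L[ℝ] E}
  {φg : ℝ → E → ℝ} {φy : ℝ → E → (E →L[ℝ] ℝ)} {Ψg : ℝ → E → E} {Ψy : ℝ → E → (E →L[ℝ] E)}
  {b C δ R θ' : ℝ}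

/-- Mean value inequality for `F t = φ t y − (t + b t³)` on `[g', g] ⊆ [0, δ]` (basin ball). -/
theorem phi_seg (h : SmoothHalfChart E φ Ψ A φg φy Ψg Ψy b C δ R θ') {g g' : ℝ} {y : E}
    (hg' : 0 ≤ g') (hle : g' ≤ g) (hg : g ≤ δ) (hy : ‖y‖ ≤ R) :
    |(φ g y - (g + b * g ^ 3)) - (φ g' y - (g' + b * g' ^ 3))| ≤
      C * g ^ 2 * (g + ‖y‖) * (g - g') := by
  have hC := h.C_nonneg
  have hF : ∀ t ∈ Icc g' g, HasDerivWithinAt (fun t => φ t y - (t + b * t ^ 3))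
      (φg t y - (1 + 3 * b * t ^ 2)) (Icc g' g) t := by
    intro t ht
    have ht' : t ∈ Icc 0 δ := ⟨hg'.trans ht.1, ht.2.trans hg⟩
    have h1 := (h.hasDeriv_φ t ht' y hy).mono (Icc_subset_Icc hg' hg)
    have h2 : HasDerivAt (fun t : ℝ => t + b * t ^ 3) (1 + b * (↑(3 : ℕ) * t ^ (3 - 1))) t :=
      (hasDerivAt_id t).add ((hasDerivAt_pow 3 t).const_mul b)
    have h3 : HasDerivWithinAt (fun t : ℝ => t + b * t ^ 3) (1 + 3 * b * t ^ 2) (Icc g' g) t :=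
      (h2.congr_deriv (by push_cast; ring)).hasDerivWithinAt
    exact h1.sub h3
  have hbound : ∀ t ∈ Ico g' g, ‖φg t y - (1 + 3 * b * t ^ 2)‖ ≤ C * g ^ 2 * (g + ‖y‖) := by
    intro t ht
    have ht0 : 0 ≤ t := hg'.trans ht.1
    have htg : t ≤ g := ht.2.le
    have ht' : t ∈ Icc 0 δ := ⟨ht0, htg.trans hg⟩
    rw [Real.norm_eq_abs]
    calc |φg t y - (1 + 3 * b * t ^ 2)| ≤ C * t ^ 2 * (t + ‖y‖) := h.φg_bound t ht' y hy
      _ ≤ C * g ^ 2 * (g + ‖y‖) := by gcongr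
  have := norm_image_sub_le_of_norm_deriv_le_segment' hF hbound g ⟨hle, le_rfl⟩
  rwa [Real.norm_eq_abs] at this

/-- Mean value inequality for `t ↦ Ψ t y` on `[g', g] ⊆ [0, δ]` (chart ball). -/
theorem psi_seg (h : SmoothHalfChart E φ Ψ A φg φy Ψg Ψy b C δ R θ') {g g' : ℝ} {y : E}
    (hg' : 0 ≤ g') (hle : g' ≤ g) (hg : g ≤ δ) (hy : ‖y‖ ≤ δ) :
    ‖Ψ g y - Ψ g' y‖ ≤ C * (g + ‖y‖) * (g - g') := by
  have hC := h.C_nonneg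
  have hF : ∀ t ∈ Icc g' g, HasDerivWithinAt (fun t => Ψ t y) (Ψg t y) (Icc g' g) t := fun t ht =>
    (h.hasDeriv_Ψ t ⟨hg'.trans ht.1, ht.2.trans hg⟩ y hy).mono (Icc_subset_Icc hg' hg)
  have hbound : ∀ t ∈ Ico g' g, ‖Ψg t y‖ ≤ C * (g + ‖y‖) := by
    intro t ht
    have htg : t ≤ g := ht.2.le
    calc ‖Ψg t y‖ ≤ C * (t + ‖y‖) := h.Ψg_bound t ⟨hg'.trans ht.1, htg.trans hg⟩ y hy
      _ ≤ C * (g + ‖y‖) := by gcongr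
  exact norm_image_sub_le_of_norm_deriv_le_segment' hF hbound g ⟨hle, le_rfl⟩

/-- Mean value inequality for `φ g ·` on the chart ball. -/
theorem phi_fib (h : SmoothHalfChart E φ Ψ A φg φy Ψg Ψy b C δ R θ') {g : ℝ} (hg : g ∈ Icc 0 δ)
    {y y' : E} (hy : ‖y‖ ≤ δ) (hy' : ‖y'‖ ≤ δ) :
    |φ g y - φ g y'| ≤ C * g ^ 3 * ‖y - y'‖ := by
  have := (convex_closedBall (0 : E) δ).norm_image_sub_le_of_norm_hasFDerivWithin_le
    (fun z hz => h.hasFDeriv_φ g hg z (mem_closedBall_zero_iff.mp hz))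
    (fun z hz => h.φy_bound g hg z (mem_closedBall_zero_iff.mp hz))
    (mem_closedBall_zero_iff.mpr hy') (mem_closedBall_zero_iff.mpr hy)
  rwa [Real.norm_eq_abs] at this

/-- Mean value inequality for `z ↦ Ψ g z − A z` on the ball of radius `max ‖y‖ ‖y'‖`. -/
theorem psi_fib (h : SmoothHalfChart E φ Ψ A φg φy Ψg Ψy b C δ R θ') {g : ℝ} (hg : g ∈ Icc 0 δ)
    {y y' : E} (hy : ‖y‖ ≤ δ) (hy' : ‖y'‖ ≤ δ) :
    ‖Ψ g y - Ψ g y' - A (y - y')‖ ≤ C * (g + ‖y‖ + ‖y'‖) * ‖y - y'‖ := by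
  have hC := h.C_nonneg
  set ρ := max ‖y‖ ‖y'‖ with hρ
  have hρδ : ρ ≤ δ := max_le hy hy'
  have hρR : ρ ≤ R := hρδ.trans h.δ_le_R
  have hsub : closedBall (0 : E) ρ ⊆ closedBall 0 R := closedBall_subset_closedBall hρR
  have hder : ∀ z ∈ closedBall (0 : E) ρ,
      HasFDerivWithinAt (fun z => Ψ g z - A z) (Ψy g z - A) (closedBall 0 ρ) z := by
    intro z hz
    have hzR : ‖z‖ ≤ R := (mem_closedBall_zero_iff.mp hz).trans hρR
    exact ((h.hasFDeriv_Ψ g hg z hzR).mono hsub).sub A.hasFDerivWithinAt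
  have hbound : ∀ z ∈ closedBall (0 : E) ρ, ‖Ψy g z - A‖ ≤ C * (g + ‖y‖ + ‖y'‖) := by
    intro z hz
    have hzρ : ‖z‖ ≤ ρ := mem_closedBall_zero_iff.mp hz
    have hz2 : ‖z‖ ≤ ‖y‖ + ‖y'‖ := hzρ.trans
      (max_le (le_add_of_nonneg_right (norm_nonneg _)) (le_add_of_nonneg_left (norm_nonneg _)))
    calc ‖Ψy g z - A‖ ≤ C * (g + ‖z‖) := h.Ψy_sub_A g hg z (hzρ.trans hρδ)
      _ ≤ C * (g + (‖y‖ + ‖y'‖)) := by gcongr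
      _ = C * (g + ‖y‖ + ‖y'‖) := by ring
  have := (convex_closedBall (0 : E) ρ).norm_image_sub_le_of_norm_hasFDerivWithin_le hder hbound
    (mem_closedBall_zero_iff.mpr (le_max_right _ _)) (mem_closedBall_zero_iff.mpr (le_max_left _ _))
  calc ‖Ψ g y - Ψ g y' - A (y - y')‖ = ‖(Ψ g y - A y) - (Ψ g y' - A y')‖ := by
        rw [map_sub]; congr 1; abel
    _ ≤ C * (g + ‖y‖ + ‖y'‖) * ‖y - y'‖ := this

/-- Uniform contraction of `Ψ g ·` on the basin ball. -/
theorem psi_con (h : SmoothHalfChart E φ Ψ A φg φy Ψg Ψy b C δ R θ') {g : ℝ} (hg : g ∈ Icc 0 δ)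
    {y y' : E} (hy : ‖y‖ ≤ R) (hy' : ‖y'‖ ≤ R) :
    ‖Ψ g y - Ψ g y'‖ ≤ θ' * ‖y - y'‖ :=
  (convex_closedBall (0 : E) R).norm_image_sub_le_of_norm_hasFDerivWithin_le
    (fun z hz => h.hasFDeriv_Ψ g hg z (mem_closedBall_zero_iff.mp hz))
    (fun z hz => h.Ψy_bound g hg z (mem_closedBall_zero_iff.mp hz))
    (mem_closedBall_zero_iff.mpr hy') (mem_closedBall_zero_iff.mpr hy)

/-- The second-order remainder of the fibre map on the chart. -/
theorem psi_rem (h : SmoothHalfChart E φ Ψ A φg φy Ψg Ψy b C δ R θ') {g : ℝ} (hg : g ∈ Icc 0 δ)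
    {y : E} (hy : ‖y‖ ≤ δ) :
    ‖Ψ g y - A y‖ ≤ (2 * C + 1) * (g ^ 2 + ‖y‖ ^ 2) := by
  have hC := h.C_nonneg
  have h1 : ‖Ψ g y - Ψ 0 y‖ ≤ C * (g + ‖y‖) * (g - 0) := psi_seg h le_rfl hg.1 hg.2 hy
  have h2 : ‖Ψ 0 y - Ψ 0 0 - A (y - 0)‖ ≤ C * (0 + ‖y‖ + ‖(0 : E)‖) * ‖y - 0‖ :=
    psi_fib h ⟨le_rfl, h.δ_pos.le⟩ hy (by simpa using h.δ_pos.le)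
  rw [h.Ψ_zero_zero] at h2
  simp only [sub_zero, norm_zero, zero_add, add_zero] at h1 h2
  have hg0 := hg.1
  have hy0 := norm_nonneg y
  calc ‖Ψ g y - A y‖ = ‖(Ψ g y - Ψ 0 y) + (Ψ 0 y - A y)‖ := by congr 1; abel
    _ ≤ ‖Ψ g y - Ψ 0 y‖ + ‖Ψ 0 y - A y‖ := norm_add_le _ _
    _ ≤ C * (g + ‖y‖) * g + C * ‖y‖ * ‖y‖ := add_le_add h1 h2
    _ ≤ (2 * C + 1) * (g ^ 2 + ‖y‖ ^ 2) := by
        nlinarith [sq_nonneg (g - ‖y‖), mul_nonneg hC (mul_nonneg hg0 hy0), sq_nonneg g, sq_nonneg ‖y‖]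

/-- The first-order remainder of the coupling map on the basin. -/
theorem phi_rem (h : SmoothHalfChart E φ Ψ A φg φy Ψg Ψy b C δ R θ') {g : ℝ} (hg : g ∈ Icc 0 δ)
    {y : E} (hy : ‖y‖ ≤ R) :
    |φ g y - (g + b * g ^ 3)| ≤ C * (g ^ 4 + g ^ 3 * ‖y‖) := by
  have := phi_seg h le_rfl hg.1 hg.2 hy
  rw [h.φ_zero y hy] at this
  have e1 : φ g y - (g + b * g ^ 3) - (0 - (0 + b * 0 ^ 3)) = φ g y - (g + b * g ^ 3) := by ring
  have e2 : C * g ^ 2 * (g + ‖y‖) * (g - 0) = C * (g ^ 4 + g ^ 3 * ‖y‖) := by ring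
  rwa [e1, e2] at this

/-! #### The odd extension of the coupling map -/

/-- `φ' g y = φ g y` for `g ≥ 0`, `−φ (−g) y` for `g < 0`. -/
def oddExt (φ : ℝ → E → ℝ) (g : ℝ) (y : E) : ℝ := if 0 ≤ g then φ g y else -φ (-g) y

omit [NormedAddCommGroup E] [NormedSpace ℝ E] in
theorem oddExt_of_nonneg {g : ℝ} (hg : 0 ≤ g) (y : E) : oddExt φ g y = φ g y := if_pos hg

omit [NormedAddCommGroup E] [NormedSpace ℝ E] in
theorem oddExt_neg_of_pos {t : ℝ} (ht : 0 < t) (y : E) : oddExt φ (-t) y = -φ t y := by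
  rw [oddExt, if_neg (by linarith), neg_neg]

/-- Monotonicity of the `lipschitz_base` bound in the coupling size. -/
theorem mono_aux {C a m s d d' : ℝ} (hC : 0 ≤ C) (ha : 0 ≤ a) (ham : a ≤ m) (hs : 0 ≤ s)
    (hd : 0 ≤ d) (hdd : d ≤ d') :
    C * a ^ 2 * (a + s) * d ≤ C * m ^ 2 * (m + s) * d' := by
  have hm : 0 ≤ m := ha.trans ham
  have h1 : a ^ 2 ≤ m ^ 2 := by gcongr
  have h2 : a + s ≤ m + s := by linarith
  apply mul_le_mul _ hdd hd (by positivity)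
  apply mul_le_mul _ h2 (by positivity) (by positivity)
  exact mul_le_mul_of_nonneg_left h1 hC

/-- `lipschitz_base` for the odd extension, in the ordered case `g' ≤ g`. -/
theorem base_phi (h : SmoothHalfChart E φ Ψ A φg φy Ψg Ψy b C δ R θ') {g g' : ℝ} {y : E}
    (hg : |g| ≤ δ) (hg' : |g'| ≤ δ) (hy : ‖y‖ ≤ δ) (hle : g' ≤ g) :
    |oddExt φ g y - oddExt φ g' y - (g - g') - b * (g ^ 3 - g' ^ 3)| ≤
      C * max |g| |g'| ^ 2 * (max |g| |g'| + ‖y‖) * |g - g'| := by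
  have hC := h.C_nonneg
  have hyR : ‖y‖ ≤ R := hy.trans h.δ_le_R
  have hy0 := norm_nonneg y
  rcases le_or_gt 0 g' with hg'0 | hg'neg
  · -- both nonnegative
    have hg0 : 0 ≤ g := hg'0.trans hle
    have e1 : |g| = g := abs_of_nonneg hg0
    have e2 : |g'| = g' := abs_of_nonneg hg'0
    have e3 : |g - g'| = g - g' := abs_of_nonneg (sub_nonneg.mpr hle)
    rw [e1] at hg
    rw [oddExt_of_nonneg hg0, oddExt_of_nonneg hg'0, e1, e2, e3, max_eq_left hle]
    have key := phi_seg h hg'0 hle hg hyR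
    calc |φ g y - φ g' y - (g - g') - b * (g ^ 3 - g' ^ 3)|
        = |(φ g y - (g + b * g ^ 3)) - (φ g' y - (g' + b * g' ^ 3))| := by ring_nf
      _ ≤ C * g ^ 2 * (g + ‖y‖) * (g - g') := key
  · rcases lt_or_ge g 0 with hgneg | hg0
    · -- both negative: g = -t, g' = -t', 0 < t ≤ t'
      obtain ⟨t, rfl⟩ : ∃ t, g = -t := ⟨-g, (neg_neg g).symm⟩
      obtain ⟨t', rfl⟩ : ∃ t', g' = -t' := ⟨-g', (neg_neg g').symm⟩
      have ht : 0 < t := by linarith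
      have ht' : 0 < t' := by linarith
      have htt : t ≤ t' := by linarith
      have e1 : |(-t)| = t := by rw [abs_neg, abs_of_pos ht]
      have e2 : |(-t')| = t' := by rw [abs_neg, abs_of_pos ht']
      have e3 : |(-t) - -t'| = t' - t := by
        rw [show -t - -t' = t' - t by ring, abs_of_nonneg (by linarith)]
      rw [e1] at hg
      rw [e2] at hg'
      rw [oddExt_neg_of_pos ht, oddExt_neg_of_pos ht', e1, e2, e3, max_eq_right htt]
      have key := phi_seg h ht.le htt hg' hyR
      calc |-φ t y - -φ t' y - (-t - -t') - b * ((-t) ^ 3 - (-t') ^ 3)|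
          = |(φ t' y - (t' + b * t' ^ 3)) - (φ t y - (t + b * t ^ 3))| := by ring_nf
        _ ≤ C * t' ^ 2 * (t' + ‖y‖) * (t' - t) := key
    · -- g' < 0 ≤ g: g' = -t'
      obtain ⟨t', rfl⟩ : ∃ t', g' = -t' := ⟨-g', (neg_neg g').symm⟩
      have ht' : 0 < t' := by linarith
      have e1 : |g| = g := abs_of_nonneg hg0
      have e2 : |(-t')| = t' := by rw [abs_neg, abs_of_pos ht']
      have e3 : |g - -t'| = g + t' := by rw [sub_neg_eq_add, abs_of_nonneg (by linarith)]
      rw [e1] at hg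
      rw [e2] at hg'
      rw [oddExt_of_nonneg hg0, oddExt_neg_of_pos ht', e1, e2, e3]
      set m := max g t' with hm
      have hgm : g ≤ m := le_max_left _ _
      have htm : t' ≤ m := le_max_right _ _
      have k1 := phi_rem h ⟨hg0, hg⟩ hyR
      have k2 := phi_rem h ⟨ht'.le, hg'⟩ hyR
      have m1 : C * g ^ 2 * (g + ‖y‖) * g ≤ C * m ^ 2 * (m + ‖y‖) * g :=
        mono_aux hC hg0 hgm hy0 hg0 le_rfl
      have m2 : C * t' ^ 2 * (t' + ‖y‖) * t' ≤ C * m ^ 2 * (m + ‖y‖) * t' :=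
        mono_aux hC ht'.le htm hy0 ht'.le le_rfl
      calc |φ g y - -φ t' y - (g - -t') - b * (g ^ 3 - (-t') ^ 3)|
          = |(φ g y - (g + b * g ^ 3)) + (φ t' y - (t' + b * t' ^ 3))| := by ring_nf
        _ ≤ |φ g y - (g + b * g ^ 3)| + |φ t' y - (t' + b * t' ^ 3)| := abs_add_le _ _
        _ ≤ C * (g ^ 4 + g ^ 3 * ‖y‖) + C * (t' ^ 4 + t' ^ 3 * ‖y‖) := add_le_add k1 k2
        _ = C * g ^ 2 * (g + ‖y‖) * g + C * t' ^ 2 * (t' + ‖y‖) * t' := by ring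
        _ ≤ C * m ^ 2 * (m + ‖y‖) * g + C * m ^ 2 * (m + ‖y‖) * t' := add_le_add m1 m2
        _ = C * m ^ 2 * (m + ‖y‖) * (g + t') := by ring

/-- `lipschitz_base` for the even extension of the fibre map. -/
theorem base_psi (h : SmoothHalfChart E φ Ψ A φg φy Ψg Ψy b C δ R θ') {g g' : ℝ} {y : E}
    (hg : |g| ≤ δ) (hg' : |g'| ≤ δ) (hy : ‖y‖ ≤ δ) :
    ‖Ψ |g| y - Ψ |g'| y‖ ≤ C * (|g| + |g'| + ‖y‖) * |g - g'| := by
  have hC := h.C_nonneg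
  rcases le_total |g'| |g| with hle | hle
  · have h1 := psi_seg h (abs_nonneg _) hle hg hy
    have h2 : |g| - |g'| ≤ |g - g'| := abs_sub_abs_le_abs_sub g g'
    have h3 : C * (|g| + ‖y‖) ≤ C * (|g| + |g'| + ‖y‖) :=
      mul_le_mul_of_nonneg_left (by linarith [abs_nonneg g']) hC
    exact h1.trans (mul_le_mul h3 h2 (sub_nonneg.mpr hle) (by positivity))
  · rw [norm_sub_rev]
    have h1 := psi_seg h (abs_nonneg _) hle hg' hy
    have h2 : |g'| - |g| ≤ |g - g'| := by rw [abs_sub_comm g g']; exact abs_sub_abs_le_abs_sub g' g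
    have h3 : C * (|g'| + ‖y‖) ≤ C * (|g| + |g'| + ‖y‖) :=
      mul_le_mul_of_nonneg_left (by linarith [abs_nonneg g]) hC
    exact h1.trans (mul_le_mul h3 h2 (sub_nonneg.mpr hle) (by positivity))

end SmoothBridge

open SmoothBridge Literature.MathematicalPhysics.QuantumFieldTheory in
/-- **Stub 2 — smooth half-chart ⇒ verbatim Lipschitz block** (`ParabolicBlockOfSmooth`, TRUE as typed).
[folklore] -/
theorem parabolicBlockOfSmooth :
    ∀ (E : Type) [NormedAddCommGroup E] [NormedSpace ℝ E]
      (φ : ℝ → E → ℝ) (Ψ : ℝ → E → E) (A : E →L[ℝ] E)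
      (φg : ℝ → E → ℝ) (φy : ℝ → E → (E →L[ℝ] ℝ)) (Ψg : ℝ → E → E) (Ψy : ℝ → E → (E →L[ℝ] E))
      (b C δ R θ' : ℝ),
      SmoothHalfChart E φ Ψ A φg φy Ψg Ψy b C δ R θ' →
      ∃ (φ' : ℝ → E → ℝ) (Ψ' : ℝ → E → E) (C' : ℝ), 0 < C' ∧
        (∀ g : ℝ, 0 ≤ g → ∀ y : E, φ' g y = φ g y ∧ Ψ' g y = Ψ g y) ∧
        ParabolicBlock E φ' Ψ' A b C' δ ∧ BasinBlock E φ' Ψ' b C' δ R θ' := by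
  intro E _ _ φ Ψ A φg φy Ψg Ψy b C δ R θ' h
  have hC := h.C_nonneg
  have hCC : C ≤ 2 * C + 1 := by linarith
  have hC' : (0 : ℝ) ≤ 2 * C + 1 := by linarith
  -- reduction of the odd extension to `t = |g|`
  have red_rem : ∀ (g : ℝ) (y : E),
      |oddExt φ g y - (g + b * g ^ 3)| = |φ |g| y - (|g| + b * |g| ^ 3)| := by
    intro g y
    rcases le_or_gt 0 g with hg0 | hgneg
    · rw [oddExt_of_nonneg hg0, abs_of_nonneg hg0]
    · obtain ⟨t, rfl⟩ : ∃ t, g = -t := ⟨-g, (neg_neg g).symm⟩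
      have ht : 0 < t := by linarith
      rw [oddExt_neg_of_pos ht, abs_neg, abs_of_pos ht]
      rw [show -φ t y - (-t + b * (-t) ^ 3) = -(φ t y - (t + b * t ^ 3)) by ring, abs_neg]
  have red_fib : ∀ (g : ℝ) (y y' : E),
      |oddExt φ g y - oddExt φ g y'| = |φ |g| y - φ |g| y'| := by
    intro g y y'
    rcases le_or_gt 0 g with hg0 | hgneg
    · rw [oddExt_of_nonneg hg0, oddExt_of_nonneg hg0, abs_of_nonneg hg0]
    · obtain ⟨t, rfl⟩ : ∃ t, g = -t := ⟨-g, (neg_neg g).symm⟩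
      have ht : 0 < t := by linarith
      rw [oddExt_neg_of_pos ht, oddExt_neg_of_pos ht, abs_neg, abs_of_pos ht]
      rw [show -φ t y - -φ t y' = -(φ t y - φ t y') by ring, abs_neg]
  have habs : ∀ {g : ℝ}, |g| ≤ δ → |g| ∈ Icc 0 δ := fun hg => ⟨abs_nonneg _, hg⟩
  refine ⟨oddExt φ, fun g y => Ψ |g| y, 2 * C + 1, by linarith, ?_, ⟨?_, ?_, ?_⟩, ⟨?_, ?_⟩⟩
  · intro g hg y
    exact ⟨oddExt_of_nonneg hg y, by simp only [abs_of_nonneg hg]⟩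
  · -- remainder
    intro g y hg hy
    have e4 : |g| ^ 4 = g ^ 4 := by rw [pow_abs]; exact abs_of_nonneg (by positivity)
    refine ⟨?_, ?_⟩
    · rw [red_rem]
      calc |φ |g| y - (|g| + b * |g| ^ 3)| ≤ C * (|g| ^ 4 + |g| ^ 3 * ‖y‖) :=
            phi_rem h (habs hg) (hy.trans h.δ_le_R)
        _ = C * (g ^ 4 + |g| ^ 3 * ‖y‖) := by rw [e4]
        _ ≤ (2 * C + 1) * (g ^ 4 + |g| ^ 3 * ‖y‖) := by gcongr
    · calc ‖Ψ |g| y - A y‖ ≤ (2 * C + 1) * (|g| ^ 2 + ‖y‖ ^ 2) := psi_rem h (habs hg) hy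
        _ = (2 * C + 1) * (g ^ 2 + ‖y‖ ^ 2) := by rw [sq_abs]
  · -- lipschitz_fibre
    intro g y y' hg hy hy'
    refine ⟨?_, ?_⟩
    · rw [red_fib]
      calc |φ |g| y - φ |g| y'| ≤ C * |g| ^ 3 * ‖y - y'‖ := phi_fib h (habs hg) hy hy'
        _ ≤ (2 * C + 1) * |g| ^ 3 * ‖y - y'‖ := by gcongr
    · calc ‖Ψ |g| y - Ψ |g| y' - A (y - y')‖ ≤ C * (|g| + ‖y‖ + ‖y'‖) * ‖y - y'‖ :=
            psi_fib h (habs hg) hy hy'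
        _ ≤ (2 * C + 1) * (|g| + ‖y‖ + ‖y'‖) * ‖y - y'‖ := by gcongr
  · -- lipschitz_base
    intro g g' y hg hg' hy
    refine ⟨?_, ?_⟩
    · have hmono : C * max |g| |g'| ^ 2 * (max |g| |g'| + ‖y‖) * |g - g'| ≤
          (2 * C + 1) * max |g| |g'| ^ 2 * (max |g| |g'| + ‖y‖) * |g - g'| := by
        have : 0 ≤ max |g| |g'| := (abs_nonneg g).trans (le_max_left _ _)
        gcongr
      rcases le_total g' g with hle | hle
      · exact (base_phi h hg hg' hy hle).trans hmono
      · have key := base_phi h hg' hg hy hle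
        have e1 : max |g'| |g| = max |g| |g'| := max_comm _ _
        have e2 : |g' - g| = |g - g'| := abs_sub_comm _ _
        have e3 : |oddExt φ g y - oddExt φ g' y - (g - g') - b * (g ^ 3 - g' ^ 3)| =
            |oddExt φ g' y - oddExt φ g y - (g' - g) - b * (g' ^ 3 - g ^ 3)| := by
          rw [← abs_neg]; congr 1; ring
        rw [e3]
        rw [e1, e2] at key
        exact key.trans hmono
    · calc ‖Ψ |g| y - Ψ |g'| y‖ ≤ C * (|g| + |g'| + ‖y‖) * |g - g'| := base_psi h hg hg' hy
        _ ≤ (2 * C + 1) * (|g| + |g'| + ‖y‖) * |g - g'| := by gcongr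
  · -- contraction on the basin
    intro g y y' hg hy hy'
    exact psi_con h (habs hg) hy hy'
  · -- remainder on the basin
    intro g y hg hy
    have e4 : |g| ^ 4 = g ^ 4 := by rw [pow_abs]; exact abs_of_nonneg (by positivity)
    rw [red_rem]
    calc |φ |g| y - (|g| + b * |g| ^ 3)| ≤ C * (|g| ^ 4 + |g| ^ 3 * ‖y‖) := phi_rem h (habs hg) hy
      _ = C * (g ^ 4 + |g| ^ 3 * ‖y‖) := by rw [e4]
      _ ≤ (2 * C + 1) * (g ^ 4 + |g| ^ 3 * ‖y‖) := by gcongr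

end Summit.QuantumFields.YangMills.Theorems.BalabanStepParabolic

end
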